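import Mathlib
import HarnessLib
import Literature.Analysis.FluidPDE.SuitableWeak
import Literature.Analysis.FluidPDE.LerayHopf
import Literature.Analysis.FluidPDE.ClassicalSolution
import Summits.NavierStokesRegularity.NavierStokesRegularity.Theses.QuarterJolt
import Summits.NavierStokesRegularity.NavierStokesRegularity.Theorems.QuarterJoltLocalJoltLaw
import Summits.NavierStokesRegularity.NavierStokesRegularity.Theorems.QuarterJoltTypeIJoltLaw
import Summits.NavierStokesRegularity.NavierStokesRegularity.Theorems.NoBlowupToClay

/-!
# Route QuarterJolt — crux `NoTerminalJolt` (stmt-NavierStokesRegularity-26463), LEAD line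
# `regular_split`: THE LOCAL FORM OF THE CRUX SUFFICES FOR THE ROUTE

Seat ns-ntj-p1 g5 (LEAD of the crux; `--supports 26463 --as helper`), companion of
`QuarterJoltLocalJoltLaw.lean` (the LOCAL TYPE-I JOLT LAW: in the frame with the Type-I rate at `T`,
at a singular vertex `(T, x₀)` the local jolt functional `D_R(t; x₀) = (√(T−t))⁻¹ ∫_{B_R(x₀)} ‖u(t) − u(T)‖²`
does not tend to `0`, for every `R > 0`).

Write `LocalNoTerminalJolt` («LocalNTJ») for the POINTWISE-LOCAL weakening of the crux — in the frame
(classical on `[0,T)`, Leray–Hopf on `[0,T]`, rapidly decaying datum), EVERY POINT HAS A BALL on which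
the local jolt functional tends to `0`: `∀ x₀ ∃ R > 0, D_R(·; x₀) → 0` as `t ↑ T`. It is spelled out
inline below (no definition is introduced; filing or restating items is the planner's business).

* `localNoTerminalJolt_of_noTerminalJolt : NoTerminalJolt → LocalNTJ` (squeeze, any `R`).
* `noBlowup_of_noTypeII_of_localNoTerminalJolt : NoTypeII (stmt-0056 verbatim) → LocalNTJ → NoBlowup
  (stmt-0054 verbatim)` — a Type-I first blow-up has a local jolt point
  (`NoTerminalJolt.typeI_exists_localJoltPoint`).
* `navierStokesRegularity_of_noTypeII_of_localNoTerminalJolt` — hence Clay (A)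
  (`navierStokesRegularity_of_noBlowup`, stmt-0055, landed).
* **`navierStokesRegularity_of_enstrophyQuarterLaw_of_localNoTerminalJolt :
  EnstrophyQuarterLaw → LocalNTJ → NavierStokesRegularity`** — the route's assembly
  `Theses.QuarterJolt.closes` (EQL → NTJ → JoltFlatCell → NoFlatCellVertex → Clay (A)) with its second
  crux WEAKENED from the global no-jolt statement stmt-26463 to the pointwise-local one; the supports
  are landed theorems and the slice quarter law gives the Type-I rate (`noTypeII_of_enstrophyQuarterLaw`).

So the crux the route needs is, at most, «no LOCAL terminal jolt about any point» — by the local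
Type-I jolt law this is still FALSE at every Type-I first blow-up (hence, given EQL, equivalent on the
data class to the absence of blow-up: the zero-width booking of KEY-NS #114 (1) is unchanged).

HONEST FRAMING: conditional implications between OPEN statements. Nothing here proves
`NoTerminalJolt` (stmt-26463), its local form, `EnstrophyQuarterLaw` (stmt-1574), `NoTypeII`
(stmt-0056), `NoBlowup` (stmt-0054) or Navier–Stokes regularity — all OPEN; no summit statement is
proved here and no hypothesis is claimed. Lint note: the imports carry the known `theses-cone`
advisory (files importing the route file / `Theses.LerayQuarterDissipation`), as for the route's
other landed files. [folklore]
-/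

noncomputable section

-- the summit and its single sub-problem share the name (CONVENTIONS §1), as in every Theorems file
set_option linter.dupNamespace false

namespace Summit.NavierStokesRegularity.NavierStokesRegularity.Theorems

open MeasureTheory Set Function Filter Topology Metric
open scoped NNReal ENNReal
open Literature.Analysis.FluidPDE

/-! ### The local form of the crux suffices for the route -/

/-- **`NoTerminalJolt ⇒ LocalNoTerminalJolt`** (crux stmt-26463 BY NAME ⇒ its pointwise-local form,
spelled out: in the frame, every point has a ball — indeed every ball, here `R = 1` — on which the
local jolt functional tends to `0`). Conditional on the OPEN crux; nothing is asserted about it.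
[folklore] -/
theorem localNoTerminalJolt_of_noTerminalJolt (hJ : Theses.QuarterJolt.NoTerminalJolt) :
    ∀ (ν T : ℝ), 0 < ν → 0 < T →
      ∀ (u : ℝ → EuclideanSpace ℝ (Fin 3) → EuclideanSpace ℝ (Fin 3))
        (p : ℝ → EuclideanSpace ℝ (Fin 3) → ℝ),
        Literature.Analysis.FluidPDE.IsClassicalNSSolutionOn (Set.Ico 0 T) ν 0 u p →
        Literature.Analysis.FluidPDE.IsLerayHopfOn T ν 0 (u 0) u →
        Literature.Analysis.FluidPDE.HasRapidSpatialDecay (u 0) →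
        ∀ x₀ : EuclideanSpace ℝ (Fin 3), ∃ R : ℝ, 0 < R ∧
          Filter.Tendsto
            (fun t : ℝ => (Real.sqrt (T - t))⁻¹ * ∫ x in Metric.ball x₀ R, ‖u t x - u T x‖ ^ 2)
            (nhdsWithin T (Set.Iio T)) (nhds 0) := by
  intro ν T hν hT u p hcl hLH hdec x₀
  exact ⟨1, one_pos, NoTerminalJolt.tendsto_localJoltFunctional_of_tendsto_joltFunctional hT hLH
    (hJ ν T hν hT u p hcl hLH hdec) x₀ 1⟩

/-- **`NoTypeII ∧ LocalNoTerminalJolt ⇒ NoBlowup`** (shelf statement stmt-0056 VERBATIM as first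
hypothesis; the pointwise-local form of the crux, spelled out, as second; conclusion = shelf statement
stmt-0054 VERBATIM): if every first blow-up in the frame is Type I, and every frame solution is
locally jolt-free about every point, then no first blow-up exists — a Type-I one would have a local
jolt point (`NoTerminalJolt.typeI_exists_localJoltPoint`). WEAKENS the second hypothesis of
`noBlowup_of_noTypeII_of_noTerminalJolt` (global ⇒ local, `localNoTerminalJolt_of_noTerminalJolt`).
Conditional on two OPEN statements; nothing is asserted about them. [folklore] -/
theorem noBlowup_of_noTypeII_of_localNoTerminalJolt
    (h56 : ∀ (ν T : ℝ), 0 < ν → 0 < T →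
      ∀ (u : ℝ → EuclideanSpace ℝ (Fin 3) → EuclideanSpace ℝ (Fin 3))
        (p : ℝ → EuclideanSpace ℝ (Fin 3) → ℝ),
        Literature.Analysis.FluidPDE.IsMaximalSmoothSolution ν 0 u p T →
        Literature.Analysis.FluidPDE.IsLerayHopfOn T ν 0 (u 0) u →
        Literature.Analysis.FluidPDE.HasRapidSpatialDecay (u 0) →
        Literature.Analysis.FluidPDE.IsTypeIBlowup u T)
    (hJloc : ∀ (ν T : ℝ), 0 < ν → 0 < T →
      ∀ (u : ℝ → EuclideanSpace ℝ (Fin 3) → EuclideanSpace ℝ (Fin 3))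
        (p : ℝ → EuclideanSpace ℝ (Fin 3) → ℝ),
        Literature.Analysis.FluidPDE.IsClassicalNSSolutionOn (Set.Ico 0 T) ν 0 u p →
        Literature.Analysis.FluidPDE.IsLerayHopfOn T ν 0 (u 0) u →
        Literature.Analysis.FluidPDE.HasRapidSpatialDecay (u 0) →
        ∀ x₀ : EuclideanSpace ℝ (Fin 3), ∃ R : ℝ, 0 < R ∧
          Filter.Tendsto
            (fun t : ℝ => (Real.sqrt (T - t))⁻¹ * ∫ x in Metric.ball x₀ R, ‖u t x - u T x‖ ^ 2)
            (nhdsWithin T (Set.Iio T)) (nhds 0)) :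
    ∀ (ν T : ℝ), 0 < ν → 0 < T →
      ∀ (u : ℝ → EuclideanSpace ℝ (Fin 3) → EuclideanSpace ℝ (Fin 3))
        (p : ℝ → EuclideanSpace ℝ (Fin 3) → ℝ),
        Literature.Analysis.FluidPDE.IsClassicalNSSolutionOn (Set.Ico 0 T) ν 0 u p →
        Literature.Analysis.FluidPDE.IsLerayHopfOn T ν 0 (u 0) u →
        Literature.Analysis.FluidPDE.HasRapidSpatialDecay (u 0) →
        Literature.Analysis.FluidPDE.HasSmoothExtensionPast ν 0 u T := by
  intro ν T hν hT u p hcl hLH hdec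
  by_contra hext
  obtain ⟨x₀, hx₀⟩ := NoTerminalJolt.typeI_exists_localJoltPoint hν hT ⟨hcl, hext⟩ hLH hdec
    (h56 ν T hν hT u p ⟨hcl, hext⟩ hLH hdec)
  obtain ⟨R, hR, hJR⟩ := hJloc ν T hν hT u p hcl hLH hdec x₀
  exact hx₀ R hR hJR

/-- **`NoTypeII ∧ LocalNoTerminalJolt ⇒ Clay (A)`**: the previous theorem composed with the landed frame
theorem `navierStokesRegularity_of_noBlowup` (stmt-0055). Conditional on two OPEN statements; no
summit statement is proved. [folklore] -/
theorem navierStokesRegularity_of_noTypeII_of_localNoTerminalJolt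
    (h56 : ∀ (ν T : ℝ), 0 < ν → 0 < T →
      ∀ (u : ℝ → EuclideanSpace ℝ (Fin 3) → EuclideanSpace ℝ (Fin 3))
        (p : ℝ → EuclideanSpace ℝ (Fin 3) → ℝ),
        Literature.Analysis.FluidPDE.IsMaximalSmoothSolution ν 0 u p T →
        Literature.Analysis.FluidPDE.IsLerayHopfOn T ν 0 (u 0) u →
        Literature.Analysis.FluidPDE.HasRapidSpatialDecay (u 0) →
        Literature.Analysis.FluidPDE.IsTypeIBlowup u T)
    (hJloc : ∀ (ν T : ℝ), 0 < ν → 0 < T →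
      ∀ (u : ℝ → EuclideanSpace ℝ (Fin 3) → EuclideanSpace ℝ (Fin 3))
        (p : ℝ → EuclideanSpace ℝ (Fin 3) → ℝ),
        Literature.Analysis.FluidPDE.IsClassicalNSSolutionOn (Set.Ico 0 T) ν 0 u p →
        Literature.Analysis.FluidPDE.IsLerayHopfOn T ν 0 (u 0) u →
        Literature.Analysis.FluidPDE.HasRapidSpatialDecay (u 0) →
        ∀ x₀ : EuclideanSpace ℝ (Fin 3), ∃ R : ℝ, 0 < R ∧
          Filter.Tendsto
            (fun t : ℝ => (Real.sqrt (T - t))⁻¹ * ∫ x in Metric.ball x₀ R, ‖u t x - u T x‖ ^ 2)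
            (nhdsWithin T (Set.Iio T)) (nhds 0)) :
    NavierStokesRegularity :=
  navierStokesRegularity_of_noBlowup (noBlowup_of_noTypeII_of_localNoTerminalJolt h56 hJloc)

/-- **`EnstrophyQuarterLaw ∧ LocalNoTerminalJolt ⇒ Clay (A)`** — the route's assembly
`Theses.QuarterJolt.closes : EnstrophyQuarterLaw → NoTerminalJolt → JoltFlatCell → NoFlatCellVertex →
NavierStokesRegularity` with its second crux WEAKENED from the global no-jolt statement (stmt-26463) to
the pointwise-local one («in the frame, every point has a ball on which
`(√(T−t))⁻¹ ∫_{B_R(x₀)} ‖u(t) − u(T)‖² → 0`»), the two supports being landed theorems: the slice quarter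
law at a first blow-up gives the Type-I rate (`noTypeII_of_enstrophyQuarterLaw`, via
`RecordTimeTypeI.main`), and the local Type-I jolt law does the rest. Conditional on two OPEN
statements (route crux stmt-1574 BY NAME and the local form of stmt-26463); no summit statement is
proved, and neither hypothesis is claimed. [folklore] -/
theorem navierStokesRegularity_of_enstrophyQuarterLaw_of_localNoTerminalJolt
    (hQ : Theses.QuarterJolt.EnstrophyQuarterLaw)
    (hJloc : ∀ (ν T : ℝ), 0 < ν → 0 < T →
      ∀ (u : ℝ → EuclideanSpace ℝ (Fin 3) → EuclideanSpace ℝ (Fin 3))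
        (p : ℝ → EuclideanSpace ℝ (Fin 3) → ℝ),
        Literature.Analysis.FluidPDE.IsClassicalNSSolutionOn (Set.Ico 0 T) ν 0 u p →
        Literature.Analysis.FluidPDE.IsLerayHopfOn T ν 0 (u 0) u →
        Literature.Analysis.FluidPDE.HasRapidSpatialDecay (u 0) →
        ∀ x₀ : EuclideanSpace ℝ (Fin 3), ∃ R : ℝ, 0 < R ∧
          Filter.Tendsto
            (fun t : ℝ => (Real.sqrt (T - t))⁻¹ * ∫ x in Metric.ball x₀ R, ‖u t x - u T x‖ ^ 2)
            (nhdsWithin T (Set.Iio T)) (nhds 0)) :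
    NavierStokesRegularity :=
  navierStokesRegularity_of_noTypeII_of_localNoTerminalJolt (noTypeII_of_enstrophyQuarterLaw hQ) hJloc

end Summit.NavierStokesRegularity.NavierStokesRegularity.Theorems

end
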